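import Literature.AnabelianGeometry.SemiGraphs.RestrictTerminalExtension
import Literature.AnabelianGeometry.SemiGraphs.PreimageComponentsIncidence

/-!
# `Π_{ℋ″} → Π_ℍ` has the same image as `Π_{ℋ′} → Π_ℍ` for a component `ℋ″` of `ℋ′ = φ⁻¹(ℍ)` ([SemiAnbd] Cor. 2.7 (i))

Mochizuki, *Semi-graphs of anabelioids*, Publ. RIMS **42** (2006), §2 p. 30, proof of Corollary 2.7 (i):
the restriction `ℋ′ → ℍ` of a finite étale covering and "a connected component `ℋ″` of `ℋ′`".
[cite: MochizukiSemiAnbd2006, Cor. 2.7(i) p.30]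

abc-iut cell, layer L3, D3b cut α7-1/α12-4, piece (COMP) in its consumable form (PROOF-ONLY, no
definitions): for a morphism `φ : 𝒢′ → 𝒢` with PROPER underlying morphism of semi-graphs, a sub-graph
`ℍ ⊆ 𝔾` (no open branches) and a preimage component `K` of `ℍ` (`Hom.IsPreimageComponent`), the
component `K` is clopen in the full preimage `K̄ := φ⁻¹(ℍ)` (`Hom.IsPreimageComponent.clopen`, from the
incidence lemmas `mem_verts_of_abuts` / `mem_edges_of_abuts`), hence `Π_K → Π_{K̄}` is onto
(`RestrictTerminalExtension.lean`), hence the homomorphisms `ι_{φ|_K} : Π_K → Π_ℍ` and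
`ι_{φ|_{K̄}} : Π_{K̄} → Π_ℍ` of the dictionary (D3) have the SAME IMAGE
(`Hom.IsPreimageComponent.range_ι_restrict_eq_preimage`) — the identity composed with
abc-iut-w4-d071's `range_ι_restrict_preimage_eq_comap` ((CORE), `DecompositionGroupRestrict.lean`) and
the bridge of `PreimageComponentTransport.lean` in the fallback route to clause (P3) of (D3) at the
covering of record.  Nothing here takes a side on [IUTchIII] Cor. 3.12.
-/

namespace Literature.AnabelianGeometry.SemiGraphs

open CategoryTheory CategoryTheory.Functor
open Literature.AnabelianGeometry.Anabelioids

universe w v₁ u₁ u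

namespace SemiGraphOfAnabelioids

variable {𝒢 𝒢' : SemiGraphOfAnabelioids.{v₁, u₁, u}} {φ : Hom 𝒢' 𝒢} {H : 𝒢.graph.Subgraph}
  {K : 𝒢'.graph.Subgraph}

/-- **A preimage component is clopen in the full preimage** ([SemiAnbd] p. 30, "a connected
component `ℋ″` of `ℋ′`"): over a proper base morphism and a sub-graph `ℍ` without open branches, a
branch `b` of an edge over `ℍ` abutting a vertex `v` over `ℍ` has its edge in `K` iff `v ∈ K`.
[cite: MochizukiSemiAnbd2006, Cor. 2.7(i) p.30] -/
theorem Hom.IsPreimageComponent.clopen (hK : φ.IsPreimageComponent H K)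
    (hprop : SemiGraph.IsProper φ.base) (hHg : H.toSemiGraph.IsGraph) :
    ∀ (b : 𝒢'.graph.Branch) (v : 𝒢'.graph.Vertex),
      𝒢'.graph.edgeOf b ∈ (⟨φ.base.vertexMap ⁻¹' H.verts, φ.base.edgeMap ⁻¹' H.edges⟩ :
          𝒢'.graph.Subgraph).edges →
      v ∈ (⟨φ.base.vertexMap ⁻¹' H.verts, φ.base.edgeMap ⁻¹' H.edges⟩ : 𝒢'.graph.Subgraph).verts →
      𝒢'.graph.abuts b = some v → (𝒢'.graph.edgeOf b ∈ K.edges ↔ v ∈ K.verts) :=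
  fun _ _ he _ hab => ⟨fun hb => hK.mem_verts_of_abuts hb hab,
    fun hv => hK.mem_edges_of_abuts hprop hHg hv hab he⟩

/-- **`Π_K ↠ Π_{K̄}` for a preimage component** `K` of `ℍ` inside the full preimage
`K̄ = φ⁻¹(ℍ)`, for the basepoints through any vertex `w ∈ K`.
[cite: MochizukiSemiAnbd2006, Cor. 2.7(i) p.30] -/
theorem Hom.IsPreimageComponent.pi1Map_restrictFunctor₂_preimage_surjective
    (hK : φ.IsPreimageComponent H K) (hprop : SemiGraph.IsProper φ.base)
    (hHg : H.toSemiGraph.IsGraph) (w : K.toSemiGraph.Vertex) (F' : 𝒢'.V w.1 ⥤ FintypeCat.{w}) :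
    Function.Surjective
      (pi1Map (𝒢'.restrictFunctor₂ ⟨φ.base.vertexMap ⁻¹' H.verts, φ.base.edgeMap ⁻¹' H.edges⟩ K
          hK.2.2.2.1 hK.2.2.2.2.1)
        ((𝒢'.restrict K).ρ w ⋙ F')) :=
  𝒢'.pi1Map_restrictFunctor₂_surjective hK.2.2.2.1 hK.2.2.2.2.1 (hK.clopen hprop hHg) w.1 w.2 F'

/-- **(COMP)** `image(Π_K → Π_ℍ) = image(Π_{K̄} → Π_ℍ)` ([SemiAnbd] p. 30): for a preimage component
`K ∋ w` of `ℍ` (proper base, `ℍ` a graph) and constituent basepoints `F′` of `𝒢′_w`, `F` of `𝒢_{φ w}`,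
`e : φ_w^* ⋙ F′ ≅ F`, the homomorphism `ι_{φ|_K} : Π_K → Π_ℍ` of the dictionary (D3) and its analogue
`ι_{φ|_{K̄}} : Π_{K̄} → Π_ℍ` for the full preimage `K̄ = φ⁻¹(ℍ)` (restricted with the tautological
inclusions) have the same image. [cite: MochizukiSemiAnbd2006, Cor. 2.7(i) p.30] -/
theorem Hom.IsPreimageComponent.range_ι_restrict_eq_preimage (hK : φ.IsPreimageComponent H K)
    (hprop : SemiGraph.IsProper φ.base) (hHg : H.toSemiGraph.IsGraph) (w : K.toSemiGraph.Vertex)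
    (F' : 𝒢'.V w.1 ⥤ FintypeCat.{w}) (F : 𝒢.V (φ.base.vertexMap w.1) ⥤ FintypeCat.{w})
    (e : (φ.φV w.1).pullback ⋙ F' ≅ F) :
    ((Aut.autMulEquivOfIso
          (isoWhiskerLeft ((𝒢.restrict H).ρ ⟨φ.base.vertexMap w.1, hK.2.2.2.1 w.2⟩) e)).toMonoidHom.comp
        (pi1Map (φ.restrict K H hK.2.2.2.1 hK.2.2.2.2.1).pullbackFunctor
          ((𝒢'.restrict K).ρ w ⋙ F'))).range =
      ((Aut.autMulEquivOfIso
            (isoWhiskerLeft ((𝒢.restrict H).ρ ⟨φ.base.vertexMap w.1, hK.2.2.2.1 w.2⟩) e)).toMonoidHom.comp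
          (pi1Map
            (φ.restrict ⟨φ.base.vertexMap ⁻¹' H.verts, φ.base.edgeMap ⁻¹' H.edges⟩ H
              (fun _ h => h) (fun _ h => h)).pullbackFunctor
            ((𝒢'.restrict ⟨φ.base.vertexMap ⁻¹' H.verts, φ.base.edgeMap ⁻¹' H.edges⟩).ρ
                ⟨w.1, hK.2.2.2.1 w.2⟩ ⋙ F'))).range :=
  φ.range_ι_restrict_eq_of_surjective H ⟨φ.base.vertexMap ⁻¹' H.verts, φ.base.edgeMap ⁻¹' H.edges⟩
    K hK.2.2.2.1 hK.2.2.2.2.1 (fun _ h => h) (fun _ h => h) hK.2.2.2.1 hK.2.2.2.2.1 w F' F e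
    (hK.pi1Map_restrictFunctor₂_preimage_surjective hprop hHg w F')

end SemiGraphOfAnabelioids

end Literature.AnabelianGeometry.SemiGraphs
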